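import Mathlib
import Literature.AlgebraicGeometry.Resolution.CobordantBlowupGlobal
import Literature.AlgebraicGeometry.Resolution.ExtendedReesSaturation
import Literature.AlgebraicGeometry.Resolution.MarkedIdealsLemmas
import Literature.AlgebraicGeometry.Resolution.IdealSheafLemmas
import Literature.AlgebraicGeometry.Resolution.BlowupPrincipalCharts
import HarnessLib

/-!
# The strict transform on the charts of the global cobordant blow-up

Topic: `Summits/ResolutionOfSingularities/ResolutionOfSingularities/Theorems`. Chart computations
for stub `stub_strictTransform` of the line `Sketch` of the crux
`Theses.WeightedInvariant.DatumToEmbedded` (statement `stmt-ResolutionOfSingularities-0572`) of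
the summit `Summit.ResolutionOfSingularities.ResolutionOfSingularities`; the stub itself is
`Theorems/WeightedInvariantDatumToEmbeddedStrictTransform.lean`.

Setting (J. Włodarczyk, arXiv:2203.03090, Def. 2.3.5, 3.3.12, App. Def. 5.1.1; tree:
`Literature/AlgebraicGeometry/Resolution/CobordantBlowupGlobal.lean`). For a Rees filtration `R`
on `Y` the global full cobordant blow-up `B = R.cobordantBlowup = Spec_Y ⊕ₙ 𝒥ₙ tⁿ` carries
`π : B ⟶ Y`, the coordinate `t⁻¹ = R.toA1 : B ⟶ 𝔸¹`, the exceptional ideal sheaf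
`R.exc = t⁻¹^*(x)` and the strict transform `R.strictTransform K = ⋃ₙ (π^*K : (t⁻¹)ⁿ)` of an
ideal sheaf `K` of `Y`. To keep definitional unfolding of the glued scheme `B` out of the
elaborator's way, everything here is stated for an ARBITRARY scheme `B` with morphisms
`π : B ⟶ Y`, `τ : B ⟶ 𝔸¹ = Spec ℤ[x]` and a chart `φ : Spec ⊕ₙ 𝒥ₙ(U) tⁿ ⟶ B` over an affine open
`U ⊆ Y` (an open immersion with `φ ≫ π = Spec(Γ(Y, U) → ⊕ 𝒥ₙ(U) tⁿ) ≫ (U ↪ Y)` and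
`φ ≫ τ = Spec(x ↦ t⁻¹)`, as `R.openCover.f U` is by `R.ι_π`, `R.ι_toA1`), the ideal sheaves being
the literal expressions `τ^*(x)` and `⋃ₙ (π^*K : τ^*(x)ⁿ)`:

* `mem_iSup_colon_span_singleton_pow_iff`, `comap_iSup_colon_span_singleton_pow` — the
  saturation `⋃ₙ (J : tⁿ)` in a ring and its transport along ring maps;
* `comap_idealSheaf_X_ideal`, `iSup_colon_ideal_eq` — on an affine open `W ⊆ π⁻¹U` of a locally
  Noetherian `B`, `τ^*(x)(W) = (τ♯x|_W)` and the strict transform has sections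
  `⋃ₙ (K(U)·Γ(B, W) : (τ♯x|_W)ⁿ)` (`ideal_colon`, `ideal_comap_of_le` of `MarkedIdealsLemmas`);
* `appLE_comp_appIso_hom`, `appIso_hom_appLE_X`, `iSup_colon_ideal_chart` — **through
  `Γ(B, φ(Spec ⊕ 𝒥ₙ(U) tⁿ)) ≅ ⊕ 𝒥ₙ(U) tⁿ` the strict transform on the chart IS the
  `t⁻¹`-saturation `⋃ₙ (K(U)·⊕ 𝒥ₙ(U) tⁿ : (t⁻¹)ⁿ)`** of
  `Literature/…/ExtendedReesSaturation.lean`, hence PRIME when `K(U)` is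
  (`isPrime_iSup_colon_ideal_chart`, by `IdealFiltration.isPrime_iSup_colon`) — Włodarczyk 3.3.12:
  the strict transform of an integral subscheme is integral on every chart;
* `ideal_le_of_irrelevant_le`, `exists_mem_support` — if some positive piece `𝒥ₙ(U)` is not
  contained in `K(U)` then the saturation misses the irrelevant ideal `⊕_{n>0} 𝒥ₙ(U) tⁿ`, so the
  generic point of the chart's strict transform lies off the vertex: a point of `B₊` in the
  support of the strict transform.

All proofs are glue on Mathlib and the tree; no definitions, no named facts.
-/

noncomputable section

open scoped LaurentPolynomial
open LaurentPolynomial CategoryTheory CategoryTheory.Limits AlgebraicGeometry TopologicalSpace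
open Literature.AlgebraicGeometry.Resolution

set_option linter.dupNamespace false -- mandated namespace `…Theorems.DatumToEmbedded.<Topic>`

namespace Summit.ResolutionOfSingularities.ResolutionOfSingularities.Theorems.DatumToEmbedded.StrictTransform

universe u

/-! ## Saturation by the powers of an element -/

/-- Membership in the saturation `⋃ₙ (J : tⁿ)`: `x` lies in it iff `tⁿ x ∈ J` for some `n`.
[folklore] -/
theorem mem_iSup_colon_span_singleton_pow_iff {S : Type*} [CommRing S] (J : Ideal S) (t x : S) :
    x ∈ (⨆ n : ℕ, J.colon ((Ideal.span {t} ^ n : Ideal S) : Set S)) ↔ ∃ n : ℕ, t ^ n * x ∈ J := by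
  have hmem : ∀ (n : ℕ) (y : S),
      y ∈ J.colon ((Ideal.span {t} ^ n : Ideal S) : Set S) ↔ t ^ n * y ∈ J := by
    intro n y
    rw [Ideal.span_singleton_pow]
    change y ∈ Submodule.colon J ((Submodule.span S {t ^ n} : Submodule S S) : Set S) ↔ _
    rw [Submodule.colon_span, Submodule.mem_colon_singleton, smul_eq_mul, mul_comm]
  have hdir : Directed (· ≤ ·) fun n : ℕ => J.colon ((Ideal.span {t} ^ n : Ideal S) : Set S) := by
    refine Monotone.directed_le fun m n hmn y hy => ?_
    rw [hmem] at hy ⊢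
    obtain ⟨k, rfl⟩ := Nat.exists_eq_add_of_le hmn
    rw [pow_add, mul_comm (t ^ m), mul_assoc]
    exact J.mul_mem_left _ hy
  rw [Submodule.mem_iSup_of_directed _ hdir]
  simp only [hmem]

/-- The saturation `⋃ₙ (J : sⁿ)` pulls back along a ring map `f` with `f t = s` to the
saturation of the pulled-back ideal by `t`. [folklore] -/
theorem comap_iSup_colon_span_singleton_pow {S S' : Type*} [CommRing S] [CommRing S']
    (f : S' →+* S) (J : Ideal S) (J' : Ideal S') (t : S') (s : S) (hs : f t = s)
    (hJ : J.comap f = J') :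
    (⨆ n : ℕ, J'.colon ((Ideal.span {t} ^ n : Ideal S') : Set S')) =
      (⨆ n : ℕ, J.colon ((Ideal.span {s} ^ n : Ideal S) : Set S)).comap f := by
  subst hs hJ
  ext x
  rw [Ideal.mem_comap, mem_iSup_colon_span_singleton_pow_iff,
    mem_iSup_colon_span_singleton_pow_iff]
  refine exists_congr fun n => ?_
  rw [Ideal.mem_comap, map_mul, map_pow]

/-- `Γ(Spec A, ⊤) → Γ(Spec B, ⊤)` along `Spec B → Spec A` is the given ring map, through the
canonical isomorphisms. [folklore] -/
theorem appLE_top_comp_ΓSpecIso_hom {A B : CommRingCat.{u}} (f : A ⟶ B)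
    (e : (⊤ : (Spec B).Opens) ≤ Spec.map f ⁻¹ᵁ ⊤) :
    (Spec.map f).appLE ⊤ ⊤ e ≫ (Scheme.ΓSpecIso B).hom = (Scheme.ΓSpecIso A).hom ≫ f := by
  change (Spec.map f).appLE ⊤ ((Spec.map f) ⁻¹ᵁ ⊤) le_rfl ≫ _ = _
  rw [Scheme.Hom.appLE_eq_app]
  exact Scheme.ΓSpecIso_naturality f

/-! ## The strict transform on affine opens of a scheme over `Y` and `𝔸¹`

Throughout, `B` is any scheme with morphisms `π : B ⟶ Y` and `τ : B ⟶ 𝔸¹ = Spec ℤ[x]` (for the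
full cobordant blow-up: `R.π` and the coordinate `t⁻¹ = R.toA1`); the exceptional ideal sheaf is
`τ^*(x)` and the strict transform of `K` is `⋃ₙ (π^*K : τ^*(x)ⁿ)` (`ReesFiltration.exc`,
`ReesFiltration.strictTransform`, which are these expressions for `B = R.cobordantBlowup`). -/

section OverA1

variable {Y B : Scheme.{u}} (π : B ⟶ Y)
  (τ : B ⟶ Spec (CommRingCat.of (Polynomial ReesFiltration.ZZ.{u})))

/-- On every affine open `W` of `B`, the ideal sheaf `τ^*(x)` is generated by the section
`τ♯x|_W`. [folklore] -/
theorem comap_idealSheaf_X_ideal (W : B.affineOpens) :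
    ((affineBlowup.idealSheaf (Ideal.span {(Polynomial.X : Polynomial ReesFiltration.ZZ.{u})})).comap
        τ).ideal W = Ideal.span {τ.appLE ⊤ W le_top
      ((Scheme.ΓSpecIso (CommRingCat.of (Polynomial ReesFiltration.ZZ.{u}))).inv Polynomial.X)} := by
  rw [ideal_comap_of_le τ _ ⟨⊤, isAffineOpen_top _⟩ W le_top,
    affineBlowup.idealSheaf, ideal_ofIdealTop_top, Ideal.map_span, Set.image_singleton,
    Ideal.map_span, Set.image_singleton]

/-- **Sections of the strict transform over an affine open `W ⊆ π⁻¹U`** (`B` locally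
Noetherian): the saturation `⋃ₙ (K(U)·Γ(B, W) : (τ♯x)ⁿ)` of the extension of `K(U)`. [folklore] -/
theorem iSup_colon_ideal_eq [IsLocallyNoetherian B] (K : Y.IdealSheafData)
    (U : Y.affineOpens) (W : B.affineOpens) (hW : (W : B.Opens) ≤ π ⁻¹ᵁ (U : Y.Opens)) :
    (⨆ n : ℕ, colon (K.comap π) ((affineBlowup.idealSheaf
        (Ideal.span {(Polynomial.X : Polynomial ReesFiltration.ZZ.{u})})).comap τ ^ n)).ideal W =
      ⨆ n : ℕ, ((K.ideal U).map (π.appLE U W hW).hom).colon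
        ((Ideal.span {τ.appLE ⊤ W le_top
          ((Scheme.ΓSpecIso (CommRingCat.of (Polynomial ReesFiltration.ZZ.{u}))).inv
            Polynomial.X)} ^ n : Ideal Γ(B, W)) : Set Γ(B, W)) := by
  rw [Scheme.IdealSheafData.ideal_iSup, iSup_apply]
  refine iSup_congr fun n => ?_
  rw [ideal_colon, ideal_comap_of_le π K U W hW, Scheme.IdealSheafData.ideal_pow, Pi.pow_apply,
    comap_idealSheaf_X_ideal]

variable (R : ReesFiltration Y) (U : Y.affineOpens)
  (φ : Spec (CommRingCat.of (R.sectionsRing U)) ⟶ B) [IsOpenImmersion φ]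
  (hφπ : φ ≫ π =
    Spec.map (CommRingCat.ofHom (algebraMap Γ(Y, U) (R.sectionsRing U))) ≫ U.2.fromSpec)

include hφπ in
/-- A chart `φ : Spec ⊕ 𝒥ₙ(U) tⁿ ⟶ B` over `Spec Γ(Y, U) → Y` lies over `U`. [folklore] -/
theorem image_top_le_preimage : φ ''ᵁ ⊤ ≤ π ⁻¹ᵁ (U : Y.Opens) := by
  rintro _ ⟨x, -, rfl⟩
  change (φ ≫ π) x ∈ (U : Y.Opens)
  rw [hφπ, ← SetLike.mem_coe, ← U.2.range_fromSpec]
  exact ⟨_, rfl⟩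

include hφπ in
/-- **The structure map of the chart**: through `Γ(B, φ(Spec ⊕ 𝒥ₙ(U) tⁿ)) ≅ ⊕ 𝒥ₙ(U) tⁿ`, the
pull-back `π♯ : Γ(Y, U) → Γ(B, chart)` is the structure map `a ↦ a t⁰`. [folklore] -/
theorem appLE_comp_appIso_hom :
    π.appLE U (φ ''ᵁ ⊤) (image_top_le_preimage π R U φ hφπ) ≫ (φ.appIso ⊤).hom ≫
        (Scheme.ΓSpecIso (CommRingCat.of (R.sectionsRing U))).hom =
      CommRingCat.ofHom (algebraMap Γ(Y, U) (R.sectionsRing U)) := by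
  rw [Scheme.Hom.appIso_hom', Scheme.Hom.appLE_comp_appLE_assoc, appLE_congr_hom hφπ,
    ← Scheme.Hom.appLE_comp_appLE_assoc _ _ _ ⊤ _ (by rw [U.2.fromSpec_preimage_self]) le_top,
    fromSpec_appLE_top, appLE_top_comp_ΓSpecIso_hom]
  exact Iso.inv_hom_id_assoc _ _

variable (hφA : φ ≫ τ = Spec.map (CommRingCat.ofHom (R.polyToSections U)))

include hφA in
/-- Through the same isomorphism, the section `τ♯x` over a chart with `φ ≫ τ = Spec (x ↦ t⁻¹)`
is the element `t⁻¹` of `⊕ 𝒥ₙ(U) tⁿ`. [folklore] -/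
theorem appIso_hom_appLE_X :
    (Scheme.ΓSpecIso (CommRingCat.of (R.sectionsRing U))).hom ((φ.appIso ⊤).hom
      (τ.appLE ⊤ (φ ''ᵁ ⊤) le_top
        ((Scheme.ΓSpecIso (CommRingCat.of (Polynomial ReesFiltration.ZZ.{u}))).inv Polynomial.X))) =
      ⟨T (-1), (R.filtration U).T_neg_one_mem_extendedRees⟩ := by
  rw [Scheme.Hom.appIso_hom', ← CommRingCat.comp_apply, ← CommRingCat.comp_apply,
    Scheme.Hom.appLE_comp_appLE_assoc, appLE_congr_hom hφA, appLE_top_comp_ΓSpecIso_hom,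
    CommRingCat.comp_apply, Iso.inv_hom_id_apply]
  exact R.polyToSections_X U

include hφπ hφA in
/-- **The strict transform on the chart is the `t⁻¹`-saturation**: through
`Γ(B, chart) ≅ ⊕ 𝒥ₙ(U) tⁿ`, the sections of `⋃ₙ (π^*K : τ^*(x)ⁿ)` over the chart are the
`t⁻¹`-saturation `⋃ₙ (K(U)·⊕ 𝒥ₙ(U) tⁿ : (t⁻¹)ⁿ)` of `ExtendedReesSaturation.lean`. [folklore] -/
theorem iSup_colon_ideal_chart [IsLocallyNoetherian B] (K : Y.IdealSheafData) :
    (⨆ n : ℕ, colon (K.comap π) ((affineBlowup.idealSheaf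
        (Ideal.span {(Polynomial.X : Polynomial ReesFiltration.ZZ.{u})})).comap τ ^ n)).ideal
        ⟨φ ''ᵁ ⊤, (isAffineOpen_top _).image_of_isOpenImmersion φ⟩ =
      (⨆ n : ℕ, ((K.ideal U).map (algebraMap Γ(Y, U) (R.sectionsRing U))).colon
        ((Ideal.span {(⟨T (-1), (R.filtration U).T_neg_one_mem_extendedRees⟩ : R.sectionsRing U)} ^ n :
          Ideal (R.sectionsRing U)) : Set (R.sectionsRing U))).comap
        ((φ.appIso ⊤).hom ≫ (Scheme.ΓSpecIso (CommRingCat.of (R.sectionsRing U))).hom).hom := by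
  have h1 : ((K.ideal U).map (π.appLE U (φ ''ᵁ ⊤) (image_top_le_preimage π R U φ hφπ)).hom).map
      ((φ.appIso ⊤).hom ≫ (Scheme.ΓSpecIso (CommRingCat.of (R.sectionsRing U))).hom).hom =
      (K.ideal U).map (algebraMap Γ(Y, U) (R.sectionsRing U)) := by
    rw [Ideal.map_map, ← CommRingCat.hom_comp, appLE_comp_appIso_hom π R U φ hφπ]
    rfl
  have h2 : ((φ.appIso ⊤).hom ≫ (Scheme.ΓSpecIso (CommRingCat.of (R.sectionsRing U))).hom).hom
      (τ.appLE ⊤ (φ ''ᵁ ⊤) le_top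
        ((Scheme.ΓSpecIso (CommRingCat.of (Polynomial ReesFiltration.ZZ.{u}))).inv Polynomial.X)) =
      ⟨T (-1), (R.filtration U).T_neg_one_mem_extendedRees⟩ := by
    rw [CommRingCat.hom_comp, RingHom.comp_apply]
    exact appIso_hom_appLE_X τ R U φ hφA
  have h3 : ((K.ideal U).map (algebraMap Γ(Y, U) (R.sectionsRing U))).comap
      ((φ.appIso ⊤).hom ≫ (Scheme.ΓSpecIso (CommRingCat.of (R.sectionsRing U))).hom).hom =
      (K.ideal U).map (π.appLE U (φ ''ᵁ ⊤) (image_top_le_preimage π R U φ hφπ)).hom := by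
    rw [← h1]
    exact Ideal.comap_map_of_bijective _ (ConcreteCategory.bijective_of_isIso
      ((φ.appIso ⊤).hom ≫ (Scheme.ΓSpecIso (CommRingCat.of (R.sectionsRing U))).hom))
  exact (iSup_colon_ideal_eq π τ K U ⟨φ ''ᵁ ⊤, (isAffineOpen_top _).image_of_isOpenImmersion φ⟩
    (image_top_le_preimage π R U φ hφπ)).trans
    (comap_iSup_colon_span_singleton_pow _ _ _ _ _ h2 h3)

end OverA1


section OverA1b

variable {Y B : Scheme.{u}} (π : B ⟶ Y)
  (τ : B ⟶ Spec (CommRingCat.of (Polynomial ReesFiltration.ZZ.{u})))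
  (R : ReesFiltration Y) (U : Y.affineOpens)
  (φ : Spec (CommRingCat.of (R.sectionsRing U)) ⟶ B) [IsOpenImmersion φ]
  (hφπ : φ ≫ π =
    Spec.map (CommRingCat.ofHom (algebraMap Γ(Y, U) (R.sectionsRing U))) ≫ U.2.fromSpec)
  (hφA : φ ≫ τ = Spec.map (CommRingCat.ofHom (R.polyToSections U)))

include hφπ hφA in
/-- **On the chart over an affine `U` on which `K(U)` is prime, the strict transform has a PRIME
ideal of sections** (`isPrime_iSup_colon`: the `t⁻¹`-saturation of a prime is prime). [folklore] -/
theorem isPrime_iSup_colon_ideal_chart [IsLocallyNoetherian B] (K : Y.IdealSheafData)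
    [(K.ideal U).IsPrime] :
    ((⨆ n : ℕ, colon (K.comap π) ((affineBlowup.idealSheaf
        (Ideal.span {(Polynomial.X : Polynomial ReesFiltration.ZZ.{u})})).comap τ ^ n)).ideal
        ⟨φ ''ᵁ ⊤, (isAffineOpen_top _).image_of_isOpenImmersion φ⟩).IsPrime :=
  (congrArg Ideal.IsPrime (iSup_colon_ideal_chart π τ R U φ hφπ hφA K)).mpr
    (Ideal.comap_isPrime _ _ (H := (R.filtration U).isPrime_iSup_colon (K.ideal U)))

/-- If the irrelevant ideal `⊕_{n>0} 𝒥ₙ(U) tⁿ` lies in the `t⁻¹`-saturation of `K(U)`, then every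
positive piece `𝒥ₙ(U)` lies in `K(U)` (read off the coefficient of `tⁿ`). [folklore] -/
theorem ideal_le_of_irrelevant_le (K : Y.IdealSheafData)
    (h : (R.filtration U).irrelevant ≤ ⨆ n : ℕ,
      ((K.ideal U).map (algebraMap Γ(Y, U) (R.sectionsRing U))).colon
        ((Ideal.span {(⟨T (-1), (R.filtration U).T_neg_one_mem_extendedRees⟩ : R.sectionsRing U)} ^ n :
          Ideal (R.sectionsRing U)) : Set (R.sectionsRing U)))
    {n : ℕ} (hn : 0 < n) : (R.ideal n).ideal U ≤ K.ideal U := by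
  intro a ha
  have hmem : (⟨C a * T (n : ℤ), (R.filtration U).C_mul_T_mem_extendedRees_iff.mpr ha⟩ :
      R.sectionsRing U) ∈ (R.filtration U).irrelevant :=
    Ideal.subset_span ⟨n, a, hn, ha, rfl⟩
  have hcoeff := ((R.filtration U).mem_iSup_colon_iff_forall_coeff_mem (K.ideal U) _).mp
    (h hmem) n
  change (C a * T (n : ℤ)).coeff (n : ℤ) ∈ K.ideal U at hcoeff
  rwa [← single_eq_C_mul_T, AddMonoidAlgebra.coeff_single, Finsupp.single_eq_same] at hcoeff

include hφπ hφA in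
/-- **A point of the strict transform off the vertex.** If the `t⁻¹`-saturation `σ` of the prime
`K(U)` does not contain the irrelevant ideal, the point `σ` of the chart lies in every open `O`
containing the chart's complement of the vertex (for `B₊`: `O = R.plus`) and in the support of
the strict transform. [folklore] -/
theorem exists_mem_support [IsLocallyNoetherian B] (K : Y.IdealSheafData) [(K.ideal U).IsPrime]
    (O : B.Opens) (hO : φ ''ᵁ R.plusChart U ≤ O)
    (hirr : ¬ (R.filtration U).irrelevant ≤ ⨆ n : ℕ,
      ((K.ideal U).map (algebraMap Γ(Y, U) (R.sectionsRing U))).colon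
        ((Ideal.span {(⟨T (-1), (R.filtration U).T_neg_one_mem_extendedRees⟩ : R.sectionsRing U)} ^ n :
          Ideal (R.sectionsRing U)) : Set (R.sectionsRing U))) :
    ∃ b ∈ O, b ∈ (⨆ n : ℕ, colon (K.comap π) ((affineBlowup.idealSheaf
        (Ideal.span {(Polynomial.X : Polynomial ReesFiltration.ZZ.{u})})).comap τ ^ n)).support := by
  haveI hσ := (R.filtration U).isPrime_iSup_colon (K.ideal U)
  let q : PrimeSpectrum (R.sectionsRing U) := ⟨_, hσ⟩
  refine ⟨φ q, hO ⟨q, (R.mem_plusChart_iff U q).mpr hirr, rfl⟩, ?_⟩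
  refine (Scheme.IdealSheafData.mem_support_iff_of_mem
    (I := ⨆ n : ℕ, colon (K.comap π) ((affineBlowup.idealSheaf
        (Ideal.span {(Polynomial.X : Polynomial ReesFiltration.ZZ.{u})})).comap τ ^ n))
    (U := ⟨φ ''ᵁ ⊤, (isAffineOpen_top _).image_of_isOpenImmersion φ⟩)
    (show φ q ∈ φ ''ᵁ ⊤ from ⟨q, trivial, rfl⟩)).mpr ?_
  refine (B.mem_zeroLocus_iff _ _).mpr fun g hg hmem => ?_
  have hg' := (congrArg (g ∈ ·) (iSup_colon_ideal_chart π τ R U φ hφπ hφA K)).mp hg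
  rw [Ideal.mem_comap, CommRingCat.hom_comp, RingHom.comp_apply, Scheme.Hom.appIso_hom'] at hg'
  have h1 : q ∈ (Spec (CommRingCat.of (R.sectionsRing U))).basicOpen
      (φ.appLE (φ ''ᵁ ⊤) ⊤ (Scheme.Hom.preimage_image_eq φ ⊤).ge g) := by
    rw [Scheme.basicOpen_appLE]
    exact ⟨trivial, hmem⟩
  exact (PrimeSpectrum.mem_basicOpen _ q).mp ((basicOpen_eq_of_affine' _).le h1) hg'

end OverA1b

end Summit.ResolutionOfSingularities.ResolutionOfSingularities.Theorems.DatumToEmbedded.StrictTransform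

end
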